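import Literature.AlgebraicGeometry.AbelianSchemes.MumfordQuotientConstructionAnyChar
import Literature.AlgebraicGeometry.AbelianSchemes.AbelianSchemeConstSubgroupQuotientEtale
import HarnessLib

/-!
# Mumford's construction of `(A′⁄K′, π, 𝒫′)` with constant `K(L′)`, any characteristic — WITH THE RELATIVE DIMENSION OF THE QUOTIENT
# ([MumfordAV1970] §13 Theorem p. 125 and §7 Thm. 4 p. 72: `dim A⁄K = dim A`)

Layer `Literature/AlgebraicGeometry/AbelianSchemes`, namespace `Literature.AlgebraicGeometry.AbelianSchemes.AbelianSchemeOver`.  THEOREMS ONLY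
(no definition, no named fact, no instance, no notation, no `sorry`); universe `u` (that of ★ `MumfordQuotientConstructionAnyChar`).  Cell
`hodgecm-mathlib` (D-0151), P6 «MOD programme», L4 DUALS road, road (A) of `stub_DUALS`, BRICK (RD) (LA6-p02 (g0) for LA4-plan DEAL #15 (B2′),
2026-09-02): the (GEO) half of the `H¹`-count bridge feeds ★ `finite_finrank_cechH1_eq_of_poincareData` (B-p04 (g42), p849049), whose binder
`hhat : hat.IsOfRelDim g` asks for the relative dimension of Mumford's quotient `Â′ = A′⁄K′` — a datum the ★ construction heads
`exists_quotient_poincare_of_constant_sections_of_isLocallyNoetherian` ∕ `…_of_constant_kOfL_baseChange_of_isLocallyNoetherian` (p847247) do not export,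
although their witness `hat := A′.quotientBy (𝟙 S′) K′ …` has it (★ `isOfRelDim_quotientBy`, [MumfordAV1970] §7 Thm. 4: `A → A⁄K` is finite étale
surjective, so the relative dimension descends, EGA IV₄ 17.7.7).  This file re-runs the two ★ proofs BY COPY with ONE extra conjunct appended LAST
inside the `∃` body: `∀ g, A′.IsOfRelDim g → hat.IsOfRelDim g`.  `--supports stmt-HodgeConjecture-24832`, count-neutral.  HONEST LABEL: HC_CM is
proved only modulo the cell's printed citations (2 remaining named inputs: hLiu418 = stmt-HodgeConjecture-24832, h413 = stmt-HodgeConjecture-24833)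
until rung 0 closes; this file is generic abelian-scheme geometry and discharges neither.

* §1 `exists_quotient_poincare_relDim_of_constant_sections_of_isLocallyNoetherian` = ★ §1 + the relative-dimension clause;
* §2 **`exists_quotient_poincare_relDim_of_constant_kOfL_baseChange_of_isLocallyNoetherian`** = ★ §2 + the clause (signature token for token, the
  clause LAST: consumers `obtain ⟨hat, π, hπmon, hπfin, hπet, hπsurj, P, hker, hP1, hrig, hpic, hsock, -, hrd⟩`).

## References
* [MumfordAV1970] D. Mumford, *Abelian Varieties* (1970), §7 Thm. 4 (p. 72) and Remark p. 69, §13 Theorem (p. 125) and its proof.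
* [MumfordFogartyKirwan1994] D. Mumford, J. Fogarty, F. Kirwan, *Geometric Invariant Theory*, 3rd ed. (1994), Ch. 6 §1 Cor. 6.8 (p. 118), §2 (p. 121).
* [MilneAV2008] J. S. Milne, *Abelian Varieties* (v2.00, 2008), I §8 pp. 36–37.
* [Grothendieck1967] A. Grothendieck, *EGA IV₄* (1967), Prop. 17.7.7 and 17.10.2.
-/

set_option autoImplicit false

noncomputable section

-- `Scheme.Modules` / `SheafOfModules` are not reducible; `(A.quotientBy …).X = A.quotientOver …` holds by `rfl` only (as in ★ `MumfordQuotientConstruction`).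
set_option backward.isDefEq.respectTransparency false

universe u

open CategoryTheory CategoryTheory.Limits AlgebraicGeometry MonoidalCategory
open scoped MonObj

namespace Literature.AlgebraicGeometry.AbelianSchemes

open Literature.AlgebraicGeometry.RelativeSpec Literature.AlgebraicGeometry.Modules
  Literature.AlgebraicGeometry.Motives Literature.AlgebraicGeometry.AbelianVarieties

namespace AbelianSchemeOver

/-! ## §1 Constant `K′ ⊆ K(L′)(S′)`: the construction with the relative dimension of `A′⁄K′` -/

/-- **MUMFORD'S CONSTRUCTION OF `(A′⁄K′, π, 𝒫′)` OVER AN AFFINE LOCALLY NOETHERIAN BASE, CONSTANT `K′`, WITH `dim (A′⁄K′ ∕ S′) = dim (A′ ∕ S′)`**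
(★ `exists_quotient_poincare_of_constant_sections_of_isLocallyNoetherian` by copy, plus the LAST conjunct `∀ g, A′.IsOfRelDim g → Â′.IsOfRelDim g`
read off the witness `Â′ := A′.quotientBy (𝟙 S′) K′` by ★ `isOfRelDim_quotientBy`: `A′ → A′⁄K′` is étale surjective, so the relative dimension of the
smooth `A′⁄K′ → S′` is that of `A′ → S′`). [cite: MumfordAV1970, §13 Theorem (p. 125) and its proof] [cite: MumfordAV1970, §7 Thm. 4 (p. 72) and Remark p. 69]
[cite: MumfordFogartyKirwan1994, Ch. 6 §1 Corollary 6.8 (p. 118) and §2 (p. 121)] [cite: Grothendieck1967, Prop. 17.7.7 and 17.10.2] -/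
theorem exists_quotient_poincare_relDim_of_constant_sections_of_isLocallyNoetherian {S' : Scheme.{u}} [IsAffine S']
    [IsLocallyNoetherian S'] (A' : AbelianSchemeOver S') (hA' : Morphisms.IsProjective A'.X.hom) {L' : A'.left.Modules} (hL' : HasRank L' 1)
    (hε' : CechPic.pullback A'.unitSection (detClass (HasRank.isFiniteLocallyFree' hL')) = 1)
    (K' : Subgroup A'.Sections) [Finite K']
    (hKinj : ∀ (Ω : Type u) [Field Ω] [IsAlgClosed Ω] (s : Spec (.of Ω) ⟶ S') (σ : A'.Sections), σ ∈ K' → σ ≠ 1 →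
      A'.restrict s σ ≠ A'.restrict s 1)
    (hKL : ∀ σ : K', A'.MemKOfL L' (σ : A'.Sections)) :
    ∃ (hat : AbelianSchemeOver S') (π : A'.X ⟶ hat.X) (_ : IsMonHom π) (_ : IsFinite π.left) (_ : Etale π.left)
      (_ : Surjective π.left) (P : (A'.prodLeft hat).Modules),
      (∀ (T : Over S') (x : T ⟶ A'.X), x ≫ π = 1 ↔
        ∃ 𝒱 : Scheme.OpenCover.{u} T.left, ∀ j, ∃ σ : K', 𝒱.f j ≫ x.left = 𝒱.f j ≫ T.hom ≫ (σ : A'.Sections).left) ∧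
      HasRank P 1 ∧
      Nonempty ((Scheme.Modules.pullback (A'.unitSlice hat)).obj P ≅ SheafOfModules.unit _) ∧
      (∀ (Ω : Type u) [Field Ω] [IsAlgClosed Ω] (b : Spec (.of Ω) ⟶ hat.X.left),
        IsHomogeneous (A'.fibre (b ≫ hat.X.hom)).toAbelianVariety ((Scheme.Modules.pullback (A'.fibreSlice hat b)).obj P)) ∧
      Nonempty ((Scheme.Modules.pullback (A'.X ◁ π).left).obj P ≅ A'.mumfordBundle L') ∧
      (∀ F : Finset hat.X.left, ∃ U : hat.X.left.Opens, IsAffineOpen U ∧ ∀ x ∈ F, x ∈ U) ∧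
      (∀ g : ℕ, A'.IsOfRelDim g → hat.IsOfRelDim g) := by
  haveI : IsCommMonObj A'.X := A'.isCommMonObj_of_isLocallyNoetherian_base
  haveI := A'.isProper
  haveI : IsSeparated (A'.X.hom ≫ 𝟙 S') := by rw [Category.comp_id]; infer_instance
  haveI : LocallyOfFiniteType (A'.X.hom ≫ 𝟙 S') := by rw [Category.comp_id]; infer_instance
  -- the four raw hypotheses of ★ `quotientBy`, discharged
  have hfinA : ∀ s : Finset A'.left, ∃ U : A'.left.Opens, IsAffineOpen U ∧ ∀ x ∈ s, x ∈ U := fun s =>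
    Morphisms.exists_isAffineOpen_forall_mem_of_isProjective hA' s
  have hcov := A'.translationActionOver_hcov_of_forall_finset (𝟙 S') K' hfinA
  have hfree := A'.forall_comp_translation_ne_of_forall_restrict_ne K' hKinj
  have hG := A'.exists_grpObj_isMonHom_quotientMk (𝟙 S') K' hcov hfree
  have hsm := A'.smooth_quotientOver_hom_of_isLocallyNoetherian (𝟙 S') K' hcov hfree
  have hgc := A'.geometricallyConnected_quotientOver_hom (𝟙 S') K' hcov
  -- the normalised linearisation of `Λ(L′)` and the rigidified descent
  obtain ⟨Φ⟩ := A'.nonempty_equivariantStructure_mumfordBundle (𝟙 S') K' hcov hL' hε' hKL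
  obtain ⟨P, hP1, hrig, hpic, hsock⟩ := A'.exists_rigidified_descent_mumfordBundle (𝟙 S') K' hcov hG hsm hgc hfree hL' hε' Φ
  exact ⟨A'.quotientBy (𝟙 S') K' hcov hG hsm hgc,
    (show A'.X ⟶ (A'.quotientBy (𝟙 S') K' hcov hG hsm hgc).X from A'.quotientMk (𝟙 S') K' hcov),
    A'.isMonHom_quotientMk (𝟙 S') K' hcov hG hsm hgc, A'.isFinite_quotientMk_left (𝟙 S') K' hcov,
    A'.etale_quotientMk_left (𝟙 S') K' hcov hfree, ⟨A'.quotientMk_left_surjective (𝟙 S') K' hcov⟩, P,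
    fun T x => A'.comp_quotientMk_eq_one_iff_exists_openCover (𝟙 S') K' hcov hG hsm hgc hfree x,
    hP1, hrig, hpic, hsock, A'.exists_isAffineOpen_forall_mem_quotientOver (𝟙 S') K' hcov hfinA,
    fun g hA => A'.isOfRelDim_quotientBy (𝟙 S') K' hcov hG hsm hgc hfree hA⟩

/-! ## §2 The base-changed situation `A′ = A ×_S S′`, `L′ = L|_{A′}`, `K(L′)` constant, with the relative dimension -/

/-- **MUMFORD'S CONSTRUCTION IN THE BASE-CHANGED SITUATION, WITH `dim (Â′ ∕ S′) = dim (A′ ∕ S′)`** — ★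
`exists_quotient_poincare_of_constant_kOfL_baseChange_of_isLocallyNoetherian` signature token for token, plus the LAST conjunct
`∀ g, (A ×_S S′).IsOfRelDim g → Â′.IsOfRelDim g` (§1; the kernel clause returned in `K(L′)` form as in ★ §2).  Consumed by the (GEO) half of the
`H¹`-count bridge (LA6-p02 (g0) `CechH1CountOfPoincareDataHead`): `hhat` of ★ `finite_finrank_cechH1_eq_of_poincareData`.
[cite: MumfordAV1970, §13 Theorem (p. 125) and its proof] [cite: MumfordAV1970, §7 Thm. 4 (p. 72)]
[cite: MumfordFogartyKirwan1994, Ch. 6 §1 Corollary 6.8 (p. 118) and §2 (p. 121)] [cite: MilneAV2008, I §8 pp. 36–37] -/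
theorem exists_quotient_poincare_relDim_of_constant_kOfL_baseChange_of_isLocallyNoetherian {S S' : Scheme.{u}} [IsAffine S']
    [IsLocallyNoetherian S'] (A : AbelianSchemeOver S) {L : A.left.Modules} (hL : HasRank L 1)
    (hε : CechPic.pullback A.unitSection (detClass (HasRank.isFiniteLocallyFree' hL)) = 1)
    (p : S' ⟶ S) (hA' : Morphisms.IsProjective (A.baseChange p).X.hom)
    (K' : Subgroup (A.baseChange p).Sections) [Finite K']
    (hKinj : ∀ (Ω : Type u) [Field Ω] [IsAlgClosed Ω] (s : Spec (.of Ω) ⟶ S') (σ : (A.baseChange p).Sections),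
      σ ∈ K' → σ ≠ 1 → (A.baseChange p).restrict s σ ≠ (A.baseChange p).restrict s 1)
    (hK' : ∀ (T : Over S') (u : T ⟶ (A.baseChange p).X),
      (A.baseChange p).MemKOfL ((Scheme.Modules.pullback (pullback.fst A.X.hom p)).obj L) u ↔
        ∃ 𝒱 : Scheme.OpenCover.{u} T.left, ∀ j, ∃ σ : K',
          𝒱.f j ≫ u.left = 𝒱.f j ≫ T.hom ≫ (σ : (A.baseChange p).Sections).left) :
    ∃ (hat : AbelianSchemeOver S') (π : (A.baseChange p).X ⟶ hat.X) (_ : IsMonHom π)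
      (_ : IsFinite π.left) (_ : Etale π.left) (_ : Surjective π.left)
      (P : ((A.baseChange p).prodLeft hat).Modules),
      (∀ (T : Over S') (u : T ⟶ (A.baseChange p).X),
        u ≫ π = 1 ↔ (A.baseChange p).MemKOfL ((Scheme.Modules.pullback (pullback.fst A.X.hom p)).obj L) u) ∧
      HasRank P 1 ∧
      Nonempty ((Scheme.Modules.pullback ((A.baseChange p).unitSlice hat)).obj P ≅ SheafOfModules.unit _) ∧
      (∀ (Ω : Type u) [Field Ω] [IsAlgClosed Ω] (b : Spec (.of Ω) ⟶ hat.X.left),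
        IsHomogeneous ((A.baseChange p).fibre (b ≫ hat.X.hom)).toAbelianVariety
          ((Scheme.Modules.pullback ((A.baseChange p).fibreSlice hat b)).obj P)) ∧
      Nonempty ((Scheme.Modules.pullback ((A.baseChange p).X ◁ π).left).obj P ≅
        (A.baseChange p).mumfordBundle ((Scheme.Modules.pullback (pullback.fst A.X.hom p)).obj L)) ∧
      (∀ F : Finset hat.X.left, ∃ U : hat.X.left.Opens, IsAffineOpen U ∧ ∀ x ∈ F, x ∈ U) ∧
      (∀ g : ℕ, (A.baseChange p).IsOfRelDim g → hat.IsOfRelDim g) := by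
  -- `K′ ⊆ K(L′)(S′)`: a section IS locally (indeed globally) a section of `K′`
  have hKL : ∀ σ : K', (A.baseChange p).MemKOfL ((Scheme.Modules.pullback (pullback.fst A.X.hom p)).obj L)
      (σ : (A.baseChange p).Sections) := fun σ =>
    (hK' _ _).2 ⟨(𝟙_ (Over S')).left.affineCover, fun j => ⟨σ, by
      rw [show (𝟙_ (Over S')).hom ≫ ((σ : (A.baseChange p).Sections)).left = (σ : (A.baseChange p).Sections).left from
        Category.id_comp _]⟩⟩
  obtain ⟨hat, π, hπ, hfin, het, hsurj, P, hker, h1, h2, h3, h4, h5, h6⟩ :=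
    (A.baseChange p).exists_quotient_poincare_relDim_of_constant_sections_of_isLocallyNoetherian hA'
      (hasRank_pullback (pullback.fst A.X.hom p) hL)
      (A.pullback_unitSection_detClass_baseChange_eq_one p hL hε) K' hKinj hKL
  exact ⟨hat, π, hπ, hfin, het, hsurj, P, fun T u => (hker T u).trans (hK' T u).symm, h1, h2, h3, h4, h5, h6⟩

end AbelianSchemeOver

end Literature.AlgebraicGeometry.AbelianSchemes

end
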